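import Summits.AtomisticToContinuum.FouriersLaw.Theorems.BondHeatUncertaintySubdiffusiveBondHeatJunctionGradedCalibration

/-!
# The Dini threshold on the relative junction axis — PART (b) of `…JunctionRatioLocality`

Support file for stmt-AtomisticToContinuum-11071, cell `decomp-a2c`, lens-1, gen 59 — file (15), PART (b) (SPLIT at gen 60 under the 400-line
cap of lean/CONVENTIONS.md §32, critic row 802).  Imports tree (12) `…JunctionGradedCalibration` ONLY (independent of PART (a) and of files
(13)/(14); the by-name frames are file (16) `…JunctionRatioLocalityFrames`).  The body below (§B) is byte-for-byte the gen-59 text; thesis,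
calibration, the de Bruijn–Erdős/Steele citation and TAGS of `DiniSeriesLaw` are in PART (a)'s docstring.  Contents: `pow_mul_le_dblChain`,
the Dini kernel `linear_of_diniRatio`, `summable_two_pow_of_dini`, `DiniSeriesLaw`, `ohmicFloor_of_diniSeriesLaw`, `boundedResponse_of_diniSeriesLaw`
(11071 BY NAME, no floor partner), `diniSeriesLaw_of_bufferedSeriesLaw`, `diniSeriesLaw_of_bufferedJunctionLaw_of_exponentFloor`,
`seriesRatio_of_diniSeriesLaw`.  `DiniSeriesLaw`: UNDECIDED · SUFFICIENT for 11071 · not FL-necessary · INSTRUMENTABLE.  No `sorry`; standard axioms.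
-/

noncomputable section

open MeasureTheory Filter Topology Set
open scoped BigOperators

namespace Summit.AtomisticToContinuum.FouriersLaw.Theorems.SubdiffusiveBondHeat

namespace EscapeGrading

open Literature.MathematicalPhysics.KineticTheory.HeatConduction
open Summit.AtomisticToContinuum.FouriersLaw.Theses.BondHeatUncertainty (BoundedResponse NonBallistic)
open Summit.AtomisticToContinuum.FouriersLaw.Theorems.SubdiffusiveBondHeat.JunctionDefectGrading
  (EmbeddedBlockLawAt BufferPassivityAt LocalityPassivityLaw BufferedSeriesLaw BufferedJunctionLaw escapeDeficit_pos)

/-! ## B. The Dini threshold -/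

/-- The doubling chain dominates the dyadic scale: `2^j · N⋆ ≤ dblChain N⋆ L₀ j`. [kernel] -/
theorem pow_mul_le_dblChain (Ns L₀ : ℕ) : ∀ j : ℕ, 2 ^ j * Ns ≤ dblChain Ns L₀ j
  | 0 => by simp [dblChain]
  | j + 1 => by
      have ih := pow_mul_le_dblChain Ns L₀ j
      show 2 ^ (j + 1) * Ns ≤ dblChain Ns L₀ j + L₀ + dblChain Ns L₀ j
      rw [pow_succ]
      nlinarith

/-- **THE DINI KERNEL (summable relative slack, pure sequence analysis).**  Let `ε ≥ 0` be antitone with `Σ_k ε(2^k) < ∞`, `r ≥ 1`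
beyond `N₂ ≥ 1`, and `(1 − ε(min u v))·(r_u + r_v) ≤ r_{u+L₀+v}` for all `u, v ≥ N₂`.  Then `a·N ≤ r_N` eventually, some `a > 0`.
Proof: past a dyadic level `J` the slack sums to `< 1/4`; along the doubling chain started at `N⋆ = max N₂ 2^J` one has
`r_{N_j} ≥ 2^j·(1 − Σ_{i<j} ε(2^{J+i})) ≥ (3/4)·2^j` (Weierstrass: `(1−e)(1−S) ≥ 1 − e − S`), and a general `N = N_j + L₀ + m`, `m ≥ N⋆`,
has `r_N ≥ (1 − ε(N⋆))·r_{N_j} ≥ (9/16)·2^j ≥ 9N/(32K)`, `K = 2N⋆ + L₀`.  The multiplicative analogue of the de Bruijn–Erdős summable-error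
lemma; at `ε ≡ 0` it is the linear growth behind `boundedResponse_of_bufferedSeriesLaw`. [kernel] -/
theorem linear_of_diniRatio {r : ℕ → ℝ} {ε : ℕ → ℝ} {L₀ N₂ : ℕ} (hε0 : ∀ n, 0 ≤ ε n) (hεa : Antitone ε)
    (hεs : Summable (fun k : ℕ => ε (2 ^ k)))
    (hr1 : ∀ n : ℕ, N₂ ≤ n → 1 ≤ r n) (hN₂ : 1 ≤ N₂)
    (hJ : ∀ u v : ℕ, N₂ ≤ u → N₂ ≤ v → (1 - ε (min u v)) * (r u + r v) ≤ r (u + L₀ + v)) :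
    ∃ a : ℝ, 0 < a ∧ ∃ N₀ : ℕ, ∀ N : ℕ, N₀ ≤ N → a * (N : ℝ) ≤ r N := by
  -- (1) a dyadic level `J` past which the slack sums to less than `1/4`
  obtain ⟨J, hJtail⟩ : ∃ J : ℕ, ∀ j : ℕ, (∑ i ∈ Finset.range j, ε (2 ^ (J + i))) < 1 / 4 := by
    obtain ⟨J, hJ'⟩ := Metric.tendsto_atTop.1 hεs.hasSum.tendsto_sum_nat (1 / 8) (by norm_num)
    refine ⟨J, fun j => ?_⟩
    have h1 := hJ' (J + j) (Nat.le_add_right _ _)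
    have h2 := hJ' J le_rfl
    rw [Real.dist_eq, Finset.sum_range_add] at h1
    rw [Real.dist_eq] at h2
    have h1' := (abs_lt.1 h1).2
    have h2' := (abs_lt.1 h2).1
    linarith
  -- (2) the chain start `N⋆ = max N₂ 2^J`; the slack along the chain is dominated by the dyadic slack past `J`
  set Ns : ℕ := max N₂ (2 ^ J) with hNs_def
  have hNsN₂ : N₂ ≤ Ns := le_max_left _ _
  have hNs1 : 1 ≤ Ns := le_trans hN₂ hNsN₂
  have hNsJ : 2 ^ J ≤ Ns := le_max_right _ _
  have hεchain : ∀ i : ℕ, ε (dblChain Ns L₀ i) ≤ ε (2 ^ (J + i)) := by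
    intro i
    apply hεa
    calc 2 ^ (J + i) = 2 ^ i * 2 ^ J := by rw [pow_add, mul_comm]
      _ ≤ 2 ^ i * Ns := Nat.mul_le_mul_left _ hNsJ
      _ ≤ dblChain Ns L₀ i := pow_mul_le_dblChain Ns L₀ i
  have hS0 : ∀ j : ℕ, 0 ≤ ∑ i ∈ Finset.range j, ε (2 ^ (J + i)) := fun j =>
    Finset.sum_nonneg fun i _ => hε0 _
  -- (3) the chain minorant `2^j·(1 − S_j) ≤ r (N_j)`
  have hchain : ∀ j : ℕ, (2 : ℝ) ^ j * (1 - ∑ i ∈ Finset.range j, ε (2 ^ (J + i))) ≤ r (dblChain Ns L₀ j) := by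
    intro j
    induction j with
    | zero => simpa [dblChain] using hr1 Ns hNsN₂
    | succ j ih =>
      have hd : N₂ ≤ dblChain Ns L₀ j := le_trans hNsN₂ (le_dblChain Ns L₀ hNs1 j).1
      have h := hJ _ _ hd hd
      rw [min_self] at h
      show (2 : ℝ) ^ (j + 1) * (1 - ∑ i ∈ Finset.range (j + 1), ε (2 ^ (J + i)))
        ≤ r (dblChain Ns L₀ j + L₀ + dblChain Ns L₀ j)
      rw [Finset.sum_range_succ, pow_succ]
      set S := ∑ i ∈ Finset.range j, ε (2 ^ (J + i)) with hS_def
      set e := ε (2 ^ (J + j)) with he_def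
      set d := r (dblChain Ns L₀ j) with hd_def
      have hSe : S + e < 1 / 4 := by
        have := hJtail (j + 1)
        rwa [Finset.sum_range_succ] at this
      have hS0' : 0 ≤ S := hS0 j
      have he0 : 0 ≤ e := hε0 _
      have hed : ε (dblChain Ns L₀ j) ≤ e := hεchain j
      have hed0 : 0 ≤ ε (dblChain Ns L₀ j) := hε0 _
      have h2j : (0 : ℝ) ≤ 2 ^ j := by positivity
      have hd0 : 0 ≤ d := le_trans (mul_nonneg h2j (by linarith)) ih
      calc (2 : ℝ) ^ j * 2 * (1 - (S + e)) ≤ (2 : ℝ) ^ j * 2 * ((1 - e) * (1 - S)) := by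
            apply mul_le_mul_of_nonneg_left _ (by positivity)
            nlinarith [mul_nonneg he0 hS0']
        _ = (1 - e) * (2 * ((2 : ℝ) ^ j * (1 - S))) := by ring
        _ ≤ (1 - e) * (2 * d) := by
            apply mul_le_mul_of_nonneg_left _ (by linarith)
            linarith
        _ ≤ (1 - ε (dblChain Ns L₀ j)) * (d + d) := by
            rw [← two_mul]
            exact mul_le_mul_of_nonneg_right (by linarith) (by linarith)
        _ ≤ r (dblChain Ns L₀ j + L₀ + dblChain Ns L₀ j) := h
  have hchain' : ∀ j : ℕ, (3 / 4 : ℝ) * 2 ^ j ≤ r (dblChain Ns L₀ j) := fun j => by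
    have h := hchain j
    have hS := hJtail j
    nlinarith [pow_nonneg (show (0 : ℝ) ≤ 2 by norm_num) j]
  -- (4) off the chain
  obtain ⟨K, hK⟩ : ∃ K : ℕ, K = 2 * Ns + L₀ := ⟨_, rfl⟩
  have hK1 : (1 : ℝ) ≤ K := by rw [hK]; exact_mod_cast (show 1 ≤ 2 * Ns + L₀ by omega)
  have hKpos : (0 : ℝ) < K := lt_of_lt_of_le one_pos hK1
  refine ⟨9 / (32 * (K : ℝ)), by positivity, 2 * Ns + L₀, fun N hN => ?_⟩
  have hex : ∃ j : ℕ, N < dblChain Ns L₀ (j + 1) + L₀ + Ns := by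
    refine ⟨N, ?_⟩
    have h := (le_dblChain Ns L₀ hNs1 (N + 1)).2
    have h2 : N < 2 ^ (N + 1) :=
      lt_trans Nat.lt_two_pow_self (Nat.pow_lt_pow_right (by norm_num) (Nat.lt_succ_self N))
    omega
  classical
  obtain ⟨j, hj, hjmin⟩ : ∃ j : ℕ, N < dblChain Ns L₀ (j + 1) + L₀ + Ns ∧
      ∀ m : ℕ, m < j → ¬ N < dblChain Ns L₀ (m + 1) + L₀ + Ns :=
    ⟨Nat.find hex, Nat.find_spec hex, fun m hm => Nat.find_min hex hm⟩
  have hj' : dblChain Ns L₀ j + L₀ + Ns ≤ N := by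
    rcases Nat.eq_zero_or_pos j with h0 | hpos
    · subst h0
      show Ns + L₀ + Ns ≤ N
      omega
    · have h := hjmin (j - 1) (by omega)
      rw [Nat.sub_add_cancel hpos] at h
      omega
  have hNj : Ns ≤ dblChain Ns L₀ j := (le_dblChain Ns L₀ hNs1 j).1
  have hm : Ns ≤ N - (dblChain Ns L₀ j + L₀) := by omega
  have hsplit : dblChain Ns L₀ j + L₀ + (N - (dblChain Ns L₀ j + L₀)) = N := by omega
  have hlaw := hJ (dblChain Ns L₀ j) (N - (dblChain Ns L₀ j + L₀)) (le_trans hNsN₂ hNj) (le_trans hNsN₂ hm)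
  rw [hsplit] at hlaw
  have hrm : 1 ≤ r (N - (dblChain Ns L₀ j + L₀)) := hr1 _ (le_trans hNsN₂ hm)
  -- the slack at this pair is at most `ε (N⋆) ≤ ε (2^J) < 1/4`
  have hεmin : ε (min (dblChain Ns L₀ j) (N - (dblChain Ns L₀ j + L₀))) ≤ 1 / 4 := by
    have h1 : ε (min (dblChain Ns L₀ j) (N - (dblChain Ns L₀ j + L₀))) ≤ ε (2 ^ J) :=
      hεa (le_trans hNsJ (le_min hNj hm))
    have h2 : ε (2 ^ J) < 1 / 4 := by
      have := hJtail 1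
      simpa using this
    linarith
  have hrN : (9 / 16 : ℝ) * 2 ^ j ≤ r N := by
    have hc := hchain' j
    have h2j : (0 : ℝ) ≤ 2 ^ j := by positivity
    calc (9 / 16 : ℝ) * 2 ^ j = (3 / 4) * ((3 / 4) * 2 ^ j) := by ring
      _ ≤ (1 - ε (min (dblChain Ns L₀ j) (N - (dblChain Ns L₀ j + L₀)))) * (r (dblChain Ns L₀ j) + 0) := by
          rw [add_zero]
          exact mul_le_mul (by linarith) hc (by positivity) (by linarith)
      _ ≤ (1 - ε (min (dblChain Ns L₀ j) (N - (dblChain Ns L₀ j + L₀))))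
            * (r (dblChain Ns L₀ j) + r (N - (dblChain Ns L₀ j + L₀))) := by
          apply mul_le_mul_of_nonneg_left _ (by linarith)
          linarith
      _ ≤ r N := hlaw
  -- size: `N < N_{j+1} + L₀ + N⋆ ≤ 2^{j+1}·K`
  have hsizeN : dblChain Ns L₀ (j + 1) + L₀ + Ns ≤ 2 ^ (j + 1) * K := by
    have h1 := dblChain_add_le Ns L₀ j
    have h1' : 1 ≤ 2 ^ j := Nat.one_le_two_pow
    show dblChain Ns L₀ j + L₀ + dblChain Ns L₀ j + L₀ + Ns ≤ 2 ^ (j + 1) * K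
    rw [pow_succ, hK]
    nlinarith
  have hsize : (N : ℝ) ≤ (2 : ℝ) ^ j * (2 * K) := by
    have h : (N : ℝ) ≤ ((2 ^ (j + 1) * K : ℕ) : ℝ) := by exact_mod_cast (hj.le.trans hsizeN)
    have e : ((2 ^ (j + 1) * K : ℕ) : ℝ) = (2 : ℝ) ^ j * (2 * K) := by push_cast; ring
    linarith [e ▸ h]
  have hq : (N : ℝ) / (2 * K) ≤ (2 : ℝ) ^ j := by
    rw [div_le_iff₀ (by positivity)]
    exact hsize
  calc 9 / (32 * (K : ℝ)) * (N : ℝ) = (9 / 16) * ((N : ℝ) / (2 * K)) := by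
        field_simp
        ring
    _ ≤ (9 / 16) * (2 : ℝ) ^ j := mul_le_mul_of_nonneg_left hq (by norm_num)
    _ ≤ r N := hrN


/-- Cauchy condensation for the Dini slack: `ε ≥ 0` antitone with `Σ_n ε(n)/n < ∞` has `Σ_k ε(2^k) < ∞`
(`summable_condensed_iff_of_nonneg`). [folklore] -/
theorem summable_two_pow_of_dini {ε : ℕ → ℝ} (hε0 : ∀ n, 0 ≤ ε n) (hεa : Antitone ε)
    (hs : Summable (fun n : ℕ => ε n / n)) : Summable (fun k : ℕ => ε (2 ^ k)) := by
  have hf0 : ∀ n : ℕ, 0 ≤ ε n / n := fun n => div_nonneg (hε0 n) (Nat.cast_nonneg n)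
  have hmono : ∀ ⦃m n : ℕ⦄, 0 < m → m ≤ n → ε n / n ≤ ε m / m := by
    intro m n hm hmn
    have hm' : (0 : ℝ) < m := by exact_mod_cast hm
    have hmn' : (m : ℝ) ≤ n := by exact_mod_cast hmn
    calc ε n / n ≤ ε m / n := div_le_div_of_nonneg_right (hεa hmn) (Nat.cast_nonneg n)
      _ ≤ ε m / m := div_le_div_of_nonneg_left (hε0 m) hm' hmn'
  have h := (summable_condensed_iff_of_nonneg hf0 hmono).2 hs
  refine h.congr fun k => ?_
  have h2 : ((2 ^ k : ℕ) : ℝ) = (2 : ℝ) ^ k := by push_cast; ring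
  rw [h2]
  field_simp

/-- **THE DINI SERIES LAW** (the priced threshold rung): for all parameters and `T > 0` there is a slack `ε : ℕ → ℝ`, `ε ≥ 0`,
antitone, with the DINI CONDITION `Σ_n ε(n)/n < ∞` (⟺ `Σ_k ε(2^k) < ∞` ⟺ `∫^∞ ε(t) dt/t < ∞`), a buffer `L₀` and a threshold `N₂`
such that `(1 − ε(min u v))·(1/E_u + 1/E_v) ≤ 1/E_{u+L₀+v}` for all `u, v ≥ N₂`.  THE THRESHOLD ON THE RELATIVE AXIS: slack `→ 0` is
`AsymptoticSeriesLaw` (FL-necessary, not sufficient: `r_N = N/log N` has slack `≍ 1/log N`, NOT Dini); slack Dini-summable is SUFFICIENT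
for 11071 with no floor partner (`boundedResponse_of_diniSeriesLaw`) — the exact analogue of the de Bruijn–Erdős relaxed-subadditivity
lemma (`a_{m+n} ≤ a_m + a_n + φ(m+n)`, `∫ φ(t)/t² < ∞` ⟹ `a_n/n` converges; Steele, Probability Theory and Combinatorial Optimization,
Thm 1.9.2).  It UNIFIES the absolute doors: `BufferedSeriesLaw ⟹ DiniSeriesLaw` (`ε ≡ 0`), `BufferedJunctionLaw ∧ ExponentFloor s ⟹
DiniSeriesLaw` for any `s > 0` (`ε(n) ≍ n^{−s}`), and `DiniSeriesLaw ⟹ ∀ ρ < 1, SeriesRatioLaw ρ` (= `AsymptoticSeriesLaw`).  NOT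
FL-necessary as typed (monotone-slack artefact: `r_N = N` off the scales `4^j`, `r_{4^j} = 4^j(1 + 1/j)` is Fourier-like with non-summable
best slack).  Tags: UNDECIDED · STRONGER than 11071's necessary shadow only by the summability price · INSTRUMENTABLE (fit `1 − ratio` against
`1/log N` vs `N^{−s}` on the census table). [piece · threshold] -/
def DiniSeriesLaw : Prop :=
  ∀ ω₂ lam β γ : ℝ, 0 < ω₂ → 0 < lam → 0 < β → 0 < γ → ∀ T : ℝ, 0 < T →
    ∃ ε : ℕ → ℝ, (∀ n : ℕ, 0 ≤ ε n) ∧ Antitone ε ∧ Summable (fun n : ℕ => ε n / n) ∧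
      ∃ L₀ N₂ : ℕ, ∀ u v : ℕ, N₂ ≤ u → N₂ ≤ v →
        (1 - ε (min u v)) * (1 / escapeDeficit ω₂ lam β γ T u + 1 / escapeDeficit ω₂ lam β γ T v)
          ≤ 1 / escapeDeficit ω₂ lam β γ T (u + L₀ + v)

/-- **`DiniSeriesLaw ⟹ OhmicFloor`** (⟺ 11071), floor-free: `r ≥ 1` from `E ≤ 1`, condensation, the Dini kernel, inversion. [this file · frame] -/
theorem ohmicFloor_of_diniSeriesLaw (hD : DiniSeriesLaw) : OhmicFloor := by
  intro ω₂ lam β γ hω hl hβ hγ T hT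
  obtain ⟨ε, hε0, hεa, hεs, L₀, N₂, hJ⟩ := hD ω₂ lam β γ hω hl hβ hγ T hT
  have hpos : ∀ n : ℕ, 2 ≤ n → 0 < escapeDeficit ω₂ lam β γ T n := fun n hn =>
    escapeDeficit_pos hω hl hβ hγ hT hn
  have hr1 : ∀ n : ℕ, max N₂ 2 ≤ n → 1 ≤ 1 / escapeDeficit ω₂ lam β γ T n := by
    intro n hn
    have hn2 : 2 ≤ n := le_trans (le_max_right _ _) hn
    rw [le_div_iff₀ (hpos n hn2), one_mul]
    exact escapeDeficit_le_one ω₂ lam β γ hω hl hβ hγ T hT n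
  have hJ' : ∀ u v : ℕ, max N₂ 2 ≤ u → max N₂ 2 ≤ v →
      (1 - ε (min u v)) * (1 / escapeDeficit ω₂ lam β γ T u + 1 / escapeDeficit ω₂ lam β γ T v)
        ≤ 1 / escapeDeficit ω₂ lam β γ T (u + L₀ + v) := fun u v hu hv =>
    hJ u v (le_trans (le_max_left _ _) hu) (le_trans (le_max_left _ _) hv)
  obtain ⟨a, ha, N₀, hN₀⟩ := linear_of_diniRatio (r := fun n => 1 / escapeDeficit ω₂ lam β γ T n) hε0 hεa
    (summable_two_pow_of_dini hε0 hεa hεs) hr1 (le_trans (by norm_num) (le_max_right _ _)) hJ'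
  refine ⟨1 / a, max N₀ 2, fun N hN => ?_⟩
  have hN0 : N₀ ≤ N := le_trans (le_max_left _ _) hN
  have hN2 : 2 ≤ N := le_trans (le_max_right _ _) hN
  have hE := hpos N hN2
  have hNpos : (0 : ℝ) < N := by exact_mod_cast (show 0 < N by omega)
  have h := hN₀ N hN0
  -- `a·N ≤ 1/E_N` ⟹ `E_N ≤ (1/a)/N`
  rw [le_div_iff₀ hE] at h
  rw [le_div_iff₀ hNpos, le_div_iff₀ ha]
  calc escapeDeficit ω₂ lam β γ T N * N * a = a * N * escapeDeficit ω₂ lam β γ T N := by ring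
    _ ≤ 1 := h

/-- **`DiniSeriesLaw ⟹ BoundedResponse` (stmt-11071, BY NAME).** [this file · frame] -/
theorem boundedResponse_of_diniSeriesLaw (hD : DiniSeriesLaw) : BoundedResponse :=
  ohmicFloor_iff_boundedResponse.1 (ohmicFloor_of_diniSeriesLaw hD)

/-- `BufferedSeriesLaw ⟹ DiniSeriesLaw` (slack `ε ≡ 0`): the Dini law is WEAKER than file 3's series law. [this file] -/
theorem diniSeriesLaw_of_bufferedSeriesLaw (hB : BufferedSeriesLaw) : DiniSeriesLaw := by
  intro ω₂ lam β γ hω hl hβ hγ T hT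
  obtain ⟨L₀, N₂, h⟩ := hB ω₂ lam β γ hω hl hβ hγ T hT
  refine ⟨fun _ => 0, fun _ => le_rfl, fun _ _ _ => le_rfl, by simp, L₀, N₂, fun u v hu hv => ?_⟩
  simpa using h u v hu hv

/-- **`BufferedJunctionLaw ∧ ExponentFloor s ⟹ DiniSeriesLaw` for every `s > 0`** — the absolute junction nodes of files (5)–(13) FACTOR
through the Dini threshold: an `O(1)` contact defect against resistances `≥ n^s/C'` is a relative slack `ε(n) = C·C'·2^s/(n+1)^s`,
antitone and Dini-summable. [this file] -/
theorem diniSeriesLaw_of_bufferedJunctionLaw_of_exponentFloor {s : ℝ} (hs : 0 < s)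
    (hB : BufferedJunctionLaw) (hF : ExponentFloor s) : DiniSeriesLaw := by
  intro ω₂ lam β γ hω hl hβ hγ T hT
  obtain ⟨C, hC, L₀, N₂, hJ⟩ := hB ω₂ lam β γ hω hl hβ hγ T hT
  obtain ⟨C', N₀, hF⟩ := hF ω₂ lam β γ hω hl hβ hγ T hT
  have hpos : ∀ n : ℕ, 2 ≤ n → 0 < escapeDeficit ω₂ lam β γ T n := fun n hn =>
    escapeDeficit_pos hω hl hβ hγ hT hn
  -- `C'` is positive (as `E_N > 0`)
  have hC'pos : 0 < C' := by
    have h := hF (max N₀ 2) (le_max_left _ _)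
    have hE := hpos (max N₀ 2) (le_max_right _ _)
    have hNpos : (0 : ℝ) < ((max N₀ 2 : ℕ) : ℝ) ^ s := by positivity
    by_contra hle
    push Not at hle
    have : C' / ((max N₀ 2 : ℕ) : ℝ) ^ s ≤ 0 := div_nonpos_of_nonpos_of_nonneg hle hNpos.le
    linarith
  -- the slack
  set A : ℝ := C * C' * (2 : ℝ) ^ s with hA
  have hA0 : 0 ≤ A := by positivity
  refine ⟨fun n => A / ((n : ℝ) + 1) ^ s, fun n => by positivity, ?_, ?_, L₀, max N₂ (max N₀ 2), fun u v hu hv => ?_⟩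
  · -- antitone
    intro m n hmn
    apply div_le_div_of_nonneg_left hA0 (by positivity)
    exact Real.rpow_le_rpow (by positivity) (by exact_mod_cast Nat.succ_le_succ hmn) hs.le
  · -- Dini-summable: `A/((n+1)^s·n) ≤ A/n^{1+s}`
    have hsum : Summable (fun n : ℕ => A * (1 / (n : ℝ) ^ (1 + s))) :=
      (Real.summable_one_div_nat_rpow.2 (by linarith)).mul_left A
    refine Summable.of_nonneg_of_le (fun n => by positivity) (fun n => ?_) hsum
    rcases Nat.eq_zero_or_pos n with h0 | hn
    · subst h0
      simp
      positivity
    have hn' : (0 : ℝ) < n := by exact_mod_cast hn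
    have hns : (n : ℝ) ^ s ≤ ((n : ℝ) + 1) ^ s := Real.rpow_le_rpow hn'.le (by linarith) hs.le
    have hnspos : (0 : ℝ) < (n : ℝ) ^ s := Real.rpow_pos_of_pos hn' s
    rw [Real.rpow_add hn', Real.rpow_one]
    rw [div_div, mul_one_div]
    apply div_le_div_of_nonneg_left hA0 (by positivity)
    calc (n : ℝ) * (n : ℝ) ^ s ≤ (n : ℝ) * ((n : ℝ) + 1) ^ s := mul_le_mul_of_nonneg_left hns hn'.le
      _ = ((n : ℝ) + 1) ^ s * n := mul_comm _ _
  · -- the inequality: `ε(min u v)·(r_u + r_v) ≥ ε(min)·r_min ≥ A/((m+1)^s)·(m^s/C') ≥ C`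
    have huN : N₂ ≤ u := le_trans (le_max_left _ _) hu
    have hvN : N₂ ≤ v := le_trans (le_max_left _ _) hv
    have hu0 : N₀ ≤ u := le_trans (le_trans (le_max_left _ _) (le_max_right _ _)) hu
    have hv0 : N₀ ≤ v := le_trans (le_trans (le_max_left _ _) (le_max_right _ _)) hv
    have hu2 : 2 ≤ u := le_trans (le_trans (le_max_right _ _) (le_max_right _ _)) hu
    have hv2 : 2 ≤ v := le_trans (le_trans (le_max_right _ _) (le_max_right _ _)) hv
    have h := hJ u v huN hvN
    -- resistances dominate `n^s/C'`
    have hr : ∀ n : ℕ, N₀ ≤ n → 2 ≤ n → (n : ℝ) ^ s / C' ≤ 1 / escapeDeficit ω₂ lam β γ T n := by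
      intro n hn0 hn2
      have hE := hpos n hn2
      have hf := hF n hn0
      have hnpos : (0 : ℝ) < (n : ℝ) ^ s := by positivity
      rw [div_le_div_iff₀ hC'pos hE, one_mul]
      calc (n : ℝ) ^ s * escapeDeficit ω₂ lam β γ T n ≤ (n : ℝ) ^ s * (C' / (n : ℝ) ^ s) :=
            mul_le_mul_of_nonneg_left hf hnpos.le
        _ = C' := by field_simp
    have hru := hr u hu0 hu2
    have hrv := hr v hv0 hv2
    have hEu := hpos u hu2
    have hEv := hpos v hv2
    set m : ℕ := min u v with hm_def
    have hm2 : 2 ≤ m := le_min hu2 hv2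
    have hm0 : N₀ ≤ m := le_min hu0 hv0
    have hmpos : (0 : ℝ) < m := by exact_mod_cast (show 0 < m by omega)
    have hm1r : (1 : ℝ) ≤ m := by exact_mod_cast (show 1 ≤ m by omega)
    -- `r_u + r_v ≥ r_m`-type bound: `r_u + r_v ≥ m^s/C'` since `m ≤ u`, `m ≤ v` and `n ↦ n^s` is monotone
    have hsum_ge : (m : ℝ) ^ s / C' ≤ 1 / escapeDeficit ω₂ lam β γ T u + 1 / escapeDeficit ω₂ lam β γ T v := by
      have hmu : (m : ℝ) ^ s / C' ≤ (u : ℝ) ^ s / C' := by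
        apply div_le_div_of_nonneg_right _ hC'pos.le
        exact Real.rpow_le_rpow hmpos.le (by exact_mod_cast min_le_left u v) hs.le
      have hrv0 : 0 ≤ 1 / escapeDeficit ω₂ lam β γ T v := by positivity
      linarith
    -- `ε(m)·(m^s/C') ≥ C`: `A/((m+1)^s)·m^s/C' = C·2^s·(m/(m+1))^s ≥ C` since `m/(m+1) ≥ 1/2`
    have hεm : C ≤ A / ((m : ℝ) + 1) ^ s * ((m : ℝ) ^ s / C') := by
      have hm1 : ((m : ℝ) + 1) ^ s ≤ (2 * (m : ℝ)) ^ s :=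
        Real.rpow_le_rpow (by positivity) (by linarith) hs.le
      have h2m : (2 * (m : ℝ)) ^ s = (2 : ℝ) ^ s * (m : ℝ) ^ s := Real.mul_rpow (by norm_num) hmpos.le
      have hm1pos : (0 : ℝ) < ((m : ℝ) + 1) ^ s := by positivity
      have hmspos : (0 : ℝ) < (m : ℝ) ^ s := by positivity
      rw [hA, div_mul_div_comm, le_div_iff₀ (by positivity)]
      calc C * (((m : ℝ) + 1) ^ s * C') ≤ C * ((2 : ℝ) ^ s * (m : ℝ) ^ s * C') := by
            apply mul_le_mul_of_nonneg_left _ hC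
            rw [← h2m]
            exact mul_le_mul_of_nonneg_right hm1 hC'pos.le
        _ = C * C' * (2 : ℝ) ^ s * (m : ℝ) ^ s := by ring
    have hεpos : 0 ≤ A / ((m : ℝ) + 1) ^ s := by positivity
    -- assemble: `(1 − ε)·(r_u + r_v) = (r_u + r_v) − ε·(r_u + r_v) ≤ (r_u + r_v) − C ≤ r_N`
    have hεsum : C ≤ A / ((m : ℝ) + 1) ^ s * (1 / escapeDeficit ω₂ lam β γ T u + 1 / escapeDeficit ω₂ lam β γ T v) :=
      le_trans hεm (mul_le_mul_of_nonneg_left hsum_ge hεpos)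
    show (1 - A / (((min u v : ℕ) : ℝ) + 1) ^ s) * (1 / escapeDeficit ω₂ lam β γ T u + 1 / escapeDeficit ω₂ lam β γ T v)
      ≤ 1 / escapeDeficit ω₂ lam β γ T (u + L₀ + v)
    rw [← hm_def]
    nlinarith

/-- **`DiniSeriesLaw ⟹ ∀ ρ < 1, SeriesRatioLaw ρ`** (= `AsymptoticSeriesLaw`, unfolded): a Dini slack tends to `0` (an antitone
`ε ≥ η > 0` would make `Σ η/n` converge). [this file] -/
theorem seriesRatio_of_diniSeriesLaw (hD : DiniSeriesLaw) :
    ∀ ρ : ℝ, ρ < 1 → ∀ ω₂ lam β γ : ℝ, 0 < ω₂ → 0 < lam → 0 < β → 0 < γ → ∀ T : ℝ, 0 < T →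
      ∃ L₀ N₂ : ℕ, ∀ u v : ℕ, N₂ ≤ u → N₂ ≤ v →
        ρ * (1 / escapeDeficit ω₂ lam β γ T u + 1 / escapeDeficit ω₂ lam β γ T v)
          ≤ 1 / escapeDeficit ω₂ lam β γ T (u + L₀ + v) := by
  intro ρ hρ ω₂ lam β γ hω hl hβ hγ T hT
  obtain ⟨ε, hε0, hεa, hεs, L₀, N₂, hJ⟩ := hD ω₂ lam β γ hω hl hβ hγ T hT
  have hpos : ∀ n : ℕ, 2 ≤ n → 0 < escapeDeficit ω₂ lam β γ T n := fun n hn =>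
    escapeDeficit_pos hω hl hβ hγ hT hn
  -- one index with small slack
  obtain ⟨n₀, hn₀⟩ : ∃ n₀ : ℕ, ε n₀ < 1 - ρ := by
    by_contra hcon
    push Not at hcon
    have h1ρ : 0 < 1 - ρ := by linarith
    have hs' : Summable (fun n : ℕ => (1 - ρ) * (1 / (n : ℝ))) := by
      refine Summable.of_nonneg_of_le (fun n => by positivity) (fun n => ?_) hεs
      rw [mul_one_div]
      exact div_le_div_of_nonneg_right (hcon n) (Nat.cast_nonneg n)
    exact Real.not_summable_one_div_natCast ((summable_mul_left_iff (ne_of_gt h1ρ)).1 hs')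
  refine ⟨L₀, max (max N₂ n₀) 2, fun u v hu hv => ?_⟩
  have huN : N₂ ≤ u := le_trans (le_trans (le_max_left _ _) (le_max_left _ _)) hu
  have hvN : N₂ ≤ v := le_trans (le_trans (le_max_left _ _) (le_max_left _ _)) hv
  have hun : n₀ ≤ u := le_trans (le_trans (le_max_right _ _) (le_max_left _ _)) hu
  have hvn : n₀ ≤ v := le_trans (le_trans (le_max_right _ _) (le_max_left _ _)) hv
  have hu2 : 2 ≤ u := le_trans (le_max_right _ _) hu
  have hv2 : 2 ≤ v := le_trans (le_max_right _ _) hv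
  have h := hJ u v huN hvN
  have hεmin : ε (min u v) ≤ ε n₀ := hεa (le_min hun hvn)
  have hsum : 0 ≤ 1 / escapeDeficit ω₂ lam β γ T u + 1 / escapeDeficit ω₂ lam β γ T v := by
    have := hpos u hu2; have := hpos v hv2; positivity
  nlinarith [mul_le_mul_of_nonneg_right (show ρ ≤ 1 - ε (min u v) by linarith) hsum]

end EscapeGrading

end Summit.AtomisticToContinuum.FouriersLaw.Theorems.SubdiffusiveBondHeat

end
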